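import Summits.BirchSwinnertonDyer.BirchSwinnertonDyer.Theorems.ManinLocalTwoThreeStevensIntegralityFormalParam
import Summits.BirchSwinnertonDyer.BirchSwinnertonDyer.Theorems.ManinLocalTwoThreeStevensIntegralityFiniteHeight
import Summits.BirchSwinnertonDyer.BirchSwinnertonDyer.Theorems.ManinLocalTwoThreeStevensIntegralityAdditiveThree
import Summits.BirchSwinnertonDyer.BirchSwinnertonDyer.Theorems.ManinLocalTwoThreeStevensIntegralityAdditiveTwo
import Summits.BirchSwinnertonDyer.BirchSwinnertonDyer.Theorems.ManinLocalTwoThreeStevensIntegralityAdditiveFive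
import HarnessLib

/-!
# Edixhoven's integrality for an abstract short-model parametrisation package: `u(vc) ∈ ℤ` (route `ManinLocalTwoThree`,
# cruxes C2 stmt-BirchSwinnertonDyer-22967 / C3 stmt-…-22968; cell bsd-f2-manin, prover p2 gen 25; CES-discharge programme,
# stage 3 step (3e))

Assembly of the lattice-free twins `…StevensIntegralityFiniteHeight` (good / multiplicative primes),
`…StevensIntegralityAdditiveFive` (additive `p ≥ 5`), `…StevensIntegralityAdditiveThree` (additive `3`, potentially
multiplicative additive primes) and `…StevensIntegralityAdditiveTwo` (additive `2`, potentially good), exactly as the tree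
assembles the fact `edixhoven_int_of_neronLattice_eq_smul_periodLattice` (`…FiniteHeightPrimesProofs`,
`…LegendreTwistProofs`, `…DeuringTwistProofs`): for a globally minimal `W'/ℚ` with a SHORT-MODEL PARAMETRISATION PACKAGE —
an elliptic short model `E : y² = x³ + a₄x + a₆` over `ℚ`, `vc • E = W'` with `u(vc) > 0`, and `z ∈ qℚ⟦q⟧` with
`log_E(z) = Σ aₙ(W')qⁿ/n`, `z·Q = P`, `w_E(z)·Q₂ = P₂` (`P, Q, P₂, Q₂ ∈ ℤ⟦q⟧`, `Q, Q₂ ≠ 0`) —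

* `padicNorm_le_one_of_formalParam_of_additive_two` — `‖u‖₂ ≤ 1` at an additive `2` (potentially good ∪ potentially
  multiplicative), abstract formal parameter;
* `padicNorm_le_one_of_shortModelParam` — `‖u(vc)‖_p ≤ 1` at EVERY prime `p`;
* `int_of_shortModelParam` — **`u(vc) ∈ ℤ`**.

With the tree's Steps 1–3 for `Λ₀(f)` this re-proves Edixhoven 1991 Prop. 2; with `…StevensShortModelParam` (Steps 1–3 for
`Λ₁(f)`) it gives the integrality of the Manin constant of the minimal model of the Stevens curve (Conrad–Edixhoven–Stein
2003, Lemma 6.1.6) — `…StevensIntegralityCES`.  Fact-free; standard axioms; no definitions.  BSD is not proved by this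
file; Manin's conjecture, C2 and C3 are not proved by this file. [cite: EdixhovenManin1991, Prop. 2]
[cite: ConradEdixhovenStein2003, §6.1, Lemma 6.1.6] [cite: Honda1970, Thm. 9 (pp. 240–241)]
-/

set_option autoImplicit false
-- lint-debt: the directory name repeats the summit name (sibling precedent `ManinLocalTwoThreeStevensCurveDatum.lean`)
set_option linter.dupNamespace false

noncomputable section

open scoped Classical

open PowerSeries Literature.NumberTheory.EllipticCurves
open _root_.WeierstrassCurve

namespace Summit.BirchSwinnertonDyer.BirchSwinnertonDyer.Theorems.ManinLocalTwoThree.StevensIntegrality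

/-- **`‖u‖₂ ≤ 1` at an ADDITIVE prime `2`**, for an abstract formal parameter (potentially good:
`…_of_norm_j_le_one_two`; potentially multiplicative: `…_of_one_lt_norm_j_two`). [cite: EdixhovenManin1991, Prop. 2] -/
theorem padicNorm_le_one_of_formalParam_of_additive_two
    (W' : WeierstrassCurve ℚ) [W'.IsElliptic] [W'.IsGloballyMinimal]
    {u : ℚ} (hCpos : 0 < u) {t₀ : ℚ⟦X⟧} (ht₀0 : constantCoeff t₀ = 0) (ht₀1 : coeff 1 t₀ = u)
    (hlog₀ : W'.formalLog.subst t₀ = C u * PowerSeries.mk fun n ↦ ((W'.LFunction n : ℤ) : ℚ) / n)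
    {P' Q' P₂' Q₂' : ℤ⟦X⟧} (hQ' : Q' ≠ 0)
    (hPQ' : t₀ * Q'.map (Int.castRingHom ℚ) = P'.map (Int.castRingHom ℚ)) (hQ₂' : Q₂' ≠ 0)
    (hPQ₂' : W'.formalW.subst t₀ * Q₂'.map (Int.castRingHom ℚ) = P₂'.map (Int.castRingHom ℚ))
    [hp : Fact (Nat.Prime 2)]
    (hΔ : (2 : ℤ) ∣ minimalDiscriminantInt W') (hc₄ : (2 : ℤ) ∣ (integralModelInt W').c₄) :
    ‖((u : ℚ) : ℚ_[2])‖ ≤ 1 := by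
  rcases le_or_gt ‖((W'.j : ℚ) : ℚ_[2])‖ 1 with hj | hj
  · exact padicNorm_le_one_of_formalParam_of_norm_j_le_one_two W' hCpos ht₀0 ht₀1 hlog₀ hQ' hPQ' hQ₂' hPQ₂'
      hΔ hc₄ hj
  · exact padicNorm_le_one_of_formalParam_of_one_lt_norm_j_two W' hCpos ht₀0 ht₀1 hlog₀ hQ' hPQ' hQ₂' hPQ₂'
      hΔ hc₄ hj

/-- **`‖u(vc)‖_p ≤ 1` at EVERY prime**, for an abstract short-model parametrisation package of a globally minimal `W'/ℚ`:
non-additive `p` by finite height (`…_of_formalParam_of_not_additive`), additive `p ≥ 5` by the semistable twist over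
`ℚ_p(p^{1/12})` (`…_of_shortModelParam_of_dvd_of_dvd`), additive `3` by the Legendre / nodal twists
(`…_of_formalParam_of_additive_three`), additive `2` by the Deuring / nodal twists (`…_of_formalParam_of_additive_two`).
[cite: EdixhovenManin1991, Prop. 2] [cite: Honda1970, Thm. 9 (pp. 240–241)] -/
theorem padicNorm_le_one_of_shortModelParam
    {W' : WeierstrassCurve ℚ} [W'.IsElliptic] [W'.IsGloballyMinimal]
    {a₄ a₆ : ℚ} {E : WeierstrassCurve ℚ} [E.IsElliptic]
    (hE : E = { a₁ := 0, a₂ := 0, a₃ := 0, a₄ := a₄, a₆ := a₆ })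
    {z : ℚ⟦X⟧} {P Q P₂ Q₂ : ℤ⟦X⟧} (hz0 : constantCoeff z = 0) (hQ : Q ≠ 0)
    (hPQ : z * Q.map (Int.castRingHom ℚ) = P.map (Int.castRingHom ℚ)) (hQ₂ : Q₂ ≠ 0)
    (hPQ₂ : E.formalW.subst z * Q₂.map (Int.castRingHom ℚ) = P₂.map (Int.castRingHom ℚ))
    (hlog : E.formalLog.subst z = PowerSeries.mk fun n ↦ ((W'.LFunction n : ℤ) : ℚ) / n)
    {vc : VariableChange ℚ} (hC : vc • E = W') (hCpos : 0 < (vc.u : ℚ))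
    {p : ℕ} [hp : Fact p.Prime] : ‖((vc.u : ℚ) : ℚ_[p])‖ ≤ 1 := by
  obtain ⟨t₀, ht₀0, ht₀1, hlog₀, P', Q', P₂', Q₂', hQ', hPQ', hQ₂', hPQ₂'⟩ :=
    exists_formalParam_of_shortModelParam hz0 hQ hPQ hQ₂ hPQ₂ hlog hC
  by_cases hadd : (p : ℤ) ∣ minimalDiscriminantInt W' ∧ (p : ℤ) ∣ (integralModelInt W').c₄
  · -- additive reduction at `p`
    by_cases h5 : 5 ≤ p
    · exact padicNorm_le_one_of_shortModelParam_of_dvd_of_dvd hE hz0 hQ hPQ hlog hC hCpos h5 hadd.1 hadd.2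
    · have hp2 := hp.out.two_le
      have hp' := hp.out
      interval_cases p
      · exact padicNorm_le_one_of_formalParam_of_additive_two W' hCpos ht₀0 ht₀1 hlog₀ hQ' hPQ' hQ₂' hPQ₂'
          (by exact_mod_cast hadd.1) (by exact_mod_cast hadd.2)
      · exact padicNorm_le_one_of_formalParam_of_additive_three W' hCpos ht₀0 ht₀1 hlog₀ hQ' hPQ' hQ₂' hPQ₂'
          (by exact_mod_cast hadd.1) (by exact_mod_cast hadd.2)
      · exact absurd hp' (by decide)
  · exact padicNorm_le_one_of_formalParam_of_not_additive W' hCpos ht₀0 ht₀1 hlog₀ hQ' hPQ' hadd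

/-- **Edixhoven's integrality for an abstract short-model parametrisation package: `u(vc) ∈ ℤ`.**  For a globally minimal
`W'/ℚ`, an elliptic short model `E : y² = x³ + a₄x + a₆` over `ℚ` with `vc • E = W'`, `u(vc) > 0`, and `z ∈ qℚ⟦q⟧` with
`log_E(z) = Σ aₙ(W')qⁿ/n`, `z·Q = P`, `w_E(z)·Q₂ = P₂` (`P, Q, P₂, Q₂ ∈ ℤ⟦q⟧`, `Q, Q₂ ≠ 0`): the scaling `u(vc)` is an
integer — no prime divides its denominator, by `padicNorm_le_one_of_shortModelParam`.  (With the tree's Steps 1–3 for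
`Λ₀(f)` this is Edixhoven 1991, Prop. 2; with `…StevensShortModelParam` it is Conrad–Edixhoven–Stein 2003, Lemma 6.1.6.)
[cite: EdixhovenManin1991, Prop. 2] [cite: ConradEdixhovenStein2003, Lemma 6.1.6] -/
theorem int_of_shortModelParam
    {W' : WeierstrassCurve ℚ} [W'.IsElliptic] [W'.IsGloballyMinimal]
    {a₄ a₆ : ℚ} {E : WeierstrassCurve ℚ} [E.IsElliptic]
    (hE : E = { a₁ := 0, a₂ := 0, a₃ := 0, a₄ := a₄, a₆ := a₆ })
    {z : ℚ⟦X⟧} {P Q P₂ Q₂ : ℤ⟦X⟧} (hz0 : constantCoeff z = 0) (hQ : Q ≠ 0)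
    (hPQ : z * Q.map (Int.castRingHom ℚ) = P.map (Int.castRingHom ℚ)) (hQ₂ : Q₂ ≠ 0)
    (hPQ₂ : E.formalW.subst z * Q₂.map (Int.castRingHom ℚ) = P₂.map (Int.castRingHom ℚ))
    (hlog : E.formalLog.subst z = PowerSeries.mk fun n ↦ ((W'.LFunction n : ℤ) : ℚ) / n)
    {vc : VariableChange ℚ} (hC : vc • E = W') (hCpos : 0 < (vc.u : ℚ)) :
    ∃ k : ℤ, (k : ℚ) = (vc.u : ℚ) := by
  set q : ℚ := (vc.u : ℚ) with hq_def
  have hden : q.den = 1 := by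
    by_contra hne
    obtain ⟨p, hp, hpq⟩ := Nat.exists_prime_and_dvd hne
    haveI := Fact.mk hp
    have hle : ‖(q : ℚ_[p])‖ ≤ 1 := padicNorm_le_one_of_shortModelParam hE hz0 hQ hPQ hQ₂ hPQ₂ hlog hC hCpos
    have hqden : ‖((q.den : ℤ) : ℚ_[p])‖ < 1 :=
      Padic.norm_intCast_lt_one_iff.mpr (Int.natCast_dvd_natCast.mpr hpq)
    have hnum : ‖((q.num : ℤ) : ℚ_[p])‖ = 1 := by
      refine le_antisymm (Padic.norm_int_le_one _) (not_lt.mp fun h ↦ ?_)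
      have hpn : p ∣ q.num.natAbs := Int.natCast_dvd.mp (Padic.norm_intCast_lt_one_iff.mp h)
      have h1 : p ∣ 1 := by
        have h' := Nat.dvd_gcd hpn hpq
        rwa [Nat.Coprime.gcd_eq_one q.reduced] at h'
      exact hp.ne_one (Nat.dvd_one.mp h1)
    have hq' : (q : ℚ_[p]) = ((q.num : ℤ) : ℚ_[p]) / ((q.den : ℤ) : ℚ_[p]) := by
      rw [Int.cast_natCast, ← Rat.cast_intCast, ← Rat.cast_natCast, ← Rat.cast_div, Rat.num_div_den]
    have hden0 : 0 < ‖((q.den : ℤ) : ℚ_[p])‖ := by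
      rw [norm_pos_iff, Int.cast_natCast, Nat.cast_ne_zero]
      exact q.den_nz
    have hlt : 1 < ‖(q : ℚ_[p])‖ := by
      rw [hq', norm_div, hnum, one_div, one_lt_inv₀ hden0]
      exact hqden
    exact absurd hle (not_le.mpr hlt)
  exact ⟨q.num, Rat.coe_int_num_of_den_eq_one hden⟩

end Summit.BirchSwinnertonDyer.BirchSwinnertonDyer.Theorems.ManinLocalTwoThree.StevensIntegrality

end
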